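import Literature.AlgebraicGeometry.Motives.HodgeLieUnitaryTimesCMCurveSU
import Literature.AlgebraicGeometry.Motives.HodgeLieUnitarySUDerived
import Literature.AlgebraicGeometry.HodgeTheory.UnitaryHodgeGroupOfRibetTypeTwoThree
import Literature.AlgebraicGeometry.HodgeTheory.WeilTypeHodgeGroupSemisimpleOfCentre
import Literature.AlgebraicGeometry.Motives.HodgeLieOfAbelianVarietySemisimpleTimesCM
import HarnessLib

/-!
# `Lie Hg(H¹(Y₅ × E_k)) ⊗ ℂ ⊇ 𝔰(𝔲(W_Y) ⊕ 𝔲(W_E))_ℂ` — the AV READING of the product brick `WeilProductCM` for TABLE X ROW 17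
# (`E_k × Y₅^{(3,2)}`: `Y` a fivefold with `End⁰ = k` imaginary quadratic of signature `(3,2)`, `E` an elliptic curve with CM by
# the SAME `k`, the diagonal `k` of Weil type `(3,3)`) (Moonen–Zarhin 1999 (5.3), (5.11); Ribet 1983 Thm. 3)

Family `hodge`, layer `Literature/AlgebraicGeometry/HodgeTheory` (cell `pub-hodgeav-hg6`, req-37 (A) Q2b, TABLE X ROW 17; eng-4 g9, brick
R17-AV; lead g4 2026-08-29). UNCONDITIONAL in its displayed shape; theorems only, no definition, no named fact, no `sorry`. HONEST
FRAMING of that cell: HC ∕ HC_AV (stmt-1333) ∕ HC_CM (stmt-3052) ∕ H2 NOT proved — a statement about `Lie Hg(Y × E)`.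

WHAT THIS FILE DOES. The Hodge-structure brick `WeilProductCM.mem_hodgeLieC_of_commute_of_skew_of_trace`
(`Motives/HodgeLieUnitaryTimesCMCurveSU`, eng-5 g7: `H ≅ H₁ ⊕ H₂` with `H₂` the `H¹` of a CM curve with the SAME `k`, balance of the
glued `k`-action, inputs `hLie₁` («every admissible `𝔤₁ ∋ Θ₁` contains every `φ₁`-commuting `ψ₁`-skew operator») and `hSL₁`
(«`𝔰𝔲_k(V₁)_ℂ` is spanned by commutators of `𝔲_k(V₁)_ℂ`»)) is READ on the complex abelian variety `Y × E` through the bicone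
`H¹(Y × E) = fst^* H¹(Y) ⊕ snd^* H¹(E)` (`BettiUniverse.pullHodgeHom` along `fst`, `snd`, `prodLift (𝟙 Y) 0`, `prodLift 0 (𝟙 E)`;
`pull_pull_eq_self_of_comp_eq_id`, `pull_pull_add_pull_pull_eq_self` — the dictionary of `CorCM/MumfordTateRankTimesCMCurve`), with
* `hLie₁` DISCHARGED for `Y = Y₅`, `dim Y = 5`, `finrank_ℚ End⁰(Y) = 2`, `φ_Y ≫ φ_Y = −d`, multiplicity `2` or `3` at `i√d`, by the tree's
  `(2,3)` core `UnitaryThetaTwoThree.mem_spanC_of_commute_of_skew` (`Motives/HodgeThetaSubalgebraUnitaryTwoThree`) through the AV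
  dictionary of F17 `UnitaryHodgeGroupOfRibetTypeTwoThree` (`exists_eq_smul_one_add_smul_bettiMapHom`,
  `finrank_eigenspace_inf_piece_oneZero∕zeroOne_eq_eigenMultiplicity`, `bettiMapHom_mul_self`; the same statement in the admissible
  shape is eng-3 g4's `mem_spanC_twoThree_of_dim_eq_five` of `UnitaryHodgeGroupAdmissibleOfRibetType`, modulo the `n − p` ∕ `1 − p`
  indexing of the Hodge operator);
* `hSL₁` DISPLAYED verbatim at `H₁ = H¹(Y)`, `φ₁ = φ_Y^*` (binder `hSL`) in the first theorem, and DISCHARGED in the primed v2 form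
  `hodgeLieC_fivefold_prod_cmCurve_of_twoThree'` by eng-5 g7's K1b `UnitarySU.mem_span_commutator_of_trace` (`Motives/HodgeLieUnitarySUDerived`);
* the balance `hbal`, `hbal'` from the row's datum `IsWeilType (Y × E) Φ 3 d` for the diagonal `Φ` (`Φ ≫ fst = fst ≫ φ_Y`,
  `Φ ≫ snd = snd ≫ χ`), via `IsWeilType.eigenMultiplicity_eq` ∕ `…_neg_eq` and the same multiplicity dictionary.

* **`hodgeLieC_fivefold_prod_cmCurve_of_twoThree`** — for EVERY polarization `ψ` of `H¹(Y × E; ℚ)`: every operator on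
  `H¹(Y × E; ℂ)` commuting with the projector `(fst ≫ prodLift (𝟙 Y) 0)^*_ℂ` and with `Φ^*_ℂ`, skew for `ψ_ℂ` and traceless on
  `W_k = ker(Φ^*_ℂ − i√d)` lies in `Lie Hg(H¹(Y × E)) ⊗ ℂ` («special members = ∅» for row 17 at the Lie level, modulo `hSL`).
Not here: the Lie→group passage (`hG` of L17's `census_weilType_general_prod`; eng-2's socket R17-S for the blocks `(5,1)`), the census.

## References
* [MoonenZarhin1999LowDim] B. Moonen, Yu. Zarhin, Math. Ann. 315 (1999), §2 (2.4), (2.7), §5 (5.3)(a), (5.11) Case 2.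
* [Ribet1983] K. A. Ribet, Amer. J. Math. 105 (1983), Thm. 3, §3.
* [Deligne1982HodgeCycles] P. Deligne, LNM 900 (1982), I §3 Prop. 3.4 and 3.6.
* [VoisinHodgeI2002] C. Voisin, Hodge Theory I (2002), §7.3.2 and Lemma 7.26.
-/

noncomputable section

open scoped TensorProduct
open CategoryTheory CategoryTheory.Limits Module

namespace Literature.AlgebraicGeometry.HodgeTheory

open Literature.AlgebraicTopology.SingularHomology
open Literature.AlgebraicGeometry.Motives
open Literature.AlgebraicGeometry.Motives.AbelianVariety
open Literature.AlgebraicGeometry.Motives.HodgeStructure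
open Literature.AlgebraicGeometry.ComplexMultiplication (bettiRep bettiRep_of bettiCohomology_map_comp_hom)

variable {Y E : AbelianVariety ℂ}

/-- `(f ≫ g)^* = f^* ∘ g^*` on `H¹(−; ℚ)`, for the linear maps. [folklore] -/
private theorem pull_comp_eq {A B C : AbelianVariety ℂ} (f : A ⟶ B) (g : B ⟶ C) :
    BettiUniverse.pull (f ≫ g).hom.hom.hom 1 = BettiUniverse.pull f.hom.hom.hom 1 ∘ₗ BettiUniverse.pull g.hom.hom.hom 1 := by
  change (bettiCohomology.map (f ≫ g).hom.hom.hom 1).hom = _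
  rw [bettiCohomology_map_comp_hom, ModuleCat.hom_comp]

/-- **ROW 17 AT THE LIE LEVEL — `Lie Hg(H¹(Y₅ × E_k)) ⊗ ℂ ⊇ 𝔰(𝔲(W_Y) ⊕ 𝔲(W_E))_ℂ`** (see the module docstring): `Y` with
`dim Y = 5`, `finrank_ℚ End⁰(Y) = 2`, `φ_Y ≫ φ_Y = −d`, multiplicity `2` or `3` at `i√d`; `E` an elliptic curve with `χ ≫ χ = −d`
(same `d`); `Φ` the diagonal endomorphism of `Y × E` (`Φ ≫ fst = fst ≫ φ_Y`, `Φ ≫ snd = snd ≫ χ`) of Weil type `(3, d)`; `hSL`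
= the displayed «`𝔰𝔲_k(H¹Y)_ℂ` is spanned by commutators» (eng-5's K1b). Then for every polarization `ψ` of `H¹(Y × E; ℚ)`:
every operator commuting with the projector `(fst ≫ prodLift (𝟙 Y) 0)^*_ℂ` and with `Φ^*_ℂ`, `ψ_ℂ`-skew and traceless on
`W_k = ker(Φ^*_ℂ − i√d)`, lies in `Lie Hg(H¹(Y × E)) ⊗ ℂ`. [cite: MoonenZarhin1999LowDim, §2 (2.4), (2.7) and §5 (5.3), (5.11)]
[cite: Ribet1983, Thm. 3] [cite: Deligne1982HodgeCycles, I §3 Prop. 3.4 and 3.6] -/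
theorem hodgeLieC_fivefold_prod_cmCurve_of_twoThree [HodgeTensorFacts.{0, 0}]
    (hY5 : Y.dim = 5) (φY : Y ⟶ Y) {d : ℕ} (hd : 0 < d) (hφY : φY ≫ φY = -(d • 𝟙 Y))
    (hE2 : Module.finrank ℚ Y.endAlgebra = 2)
    (h23 : eigenMultiplicity Y φY (Complex.I * (Real.sqrt d : ℂ)) = 2 ∨ eigenMultiplicity Y φY (Complex.I * (Real.sqrt d : ℂ)) = 3)
    (hE1 : E.dim = 1) (χ : E ⟶ E) (hχ : χ ≫ χ = -(d • 𝟙 E))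
    (Φ : Y.prod E ⟶ Y.prod E) (hΦ₁ : Φ ≫ fst Y E = fst Y E ≫ φY) (hΦ₂ : Φ ≫ snd Y E = snd Y E ≫ χ)
    (hW : IsWeilType (Y.prod E) Φ 3 d)
    (hSL : ∀ (ψ₁ : (BettiUniverse.hodge exists_isReal_hodgeModel_holds (AbelianVariety.isSmoothProjective_holds (A := Y)) 1).Polarization)
      (T : Module.End ℂ (ℂ ⊗[ℚ] bettiCohomology Y.X 1)),
      T * ((bettiCohomology.map φY.hom.hom.hom 1).hom).baseChange ℂ = ((bettiCohomology.map φY.hom.hom.hom 1).hom).baseChange ℂ * T →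
      (∀ x y, ψ₁.form.baseChange ℂ (T x) y + ψ₁.form.baseChange ℂ x (T y) = 0) →
      LinearMap.trace ℂ _ (((bettiCohomology.map φY.hom.hom.hom 1).hom).baseChange ℂ * T) = 0 →
      T ∈ Submodule.span ℂ {D : Module.End ℂ (ℂ ⊗[ℚ] bettiCohomology Y.X 1) |
        ∃ A B : Module.End ℂ (ℂ ⊗[ℚ] bettiCohomology Y.X 1),
        A * ((bettiCohomology.map φY.hom.hom.hom 1).hom).baseChange ℂ = ((bettiCohomology.map φY.hom.hom.hom 1).hom).baseChange ℂ * A ∧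
        B * ((bettiCohomology.map φY.hom.hom.hom 1).hom).baseChange ℂ = ((bettiCohomology.map φY.hom.hom.hom 1).hom).baseChange ℂ * B ∧
        (∀ x y, ψ₁.form.baseChange ℂ (A x) y + ψ₁.form.baseChange ℂ x (A y) = 0) ∧
        (∀ x y, ψ₁.form.baseChange ℂ (B x) y + ψ₁.form.baseChange ℂ x (B y) = 0) ∧ D = A * B - B * A})
    (ψ : (BettiUniverse.hodge exists_isReal_hodgeModel_holds (AbelianVariety.isSmoothProjective_holds (A := Y.prod E)) 1).Polarization) :
    ∀ (Yop : Module.End ℂ (ℂ ⊗[ℚ] bettiCohomology (Y.prod E).X 1)),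
      Yop * ((bettiCohomology.map (fst Y E ≫ prodLift (𝟙 Y) (0 : Y ⟶ E)).hom.hom.hom 1).hom).baseChange ℂ =
        ((bettiCohomology.map (fst Y E ≫ prodLift (𝟙 Y) (0 : Y ⟶ E)).hom.hom.hom 1).hom).baseChange ℂ * Yop →
      ∀ (hYΦ : Yop * ((bettiCohomology.map Φ.hom.hom.hom 1).hom).baseChange ℂ =
        ((bettiCohomology.map Φ.hom.hom.hom 1).hom).baseChange ℂ * Yop),
      (∀ x y, ψ.form.baseChange ℂ (Yop x) y + ψ.form.baseChange ℂ x (Yop y) = 0) →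
      LinearMap.trace ℂ _ (Yop.restrict fun x (hx : x ∈ Module.End.eigenspace
          (((bettiCohomology.map Φ.hom.hom.hom 1).hom).baseChange ℂ) (Complex.I * (Real.sqrt d : ℂ))) =>
        UnitaryTheta.apply_mem_eigenspace_of_commute hYΦ hx) = 0 →
      Yop ∈ (BettiUniverse.hodge exists_isReal_hodgeModel_holds (AbelianVariety.isSmoothProjective_holds (A := Y.prod E)) 1).hodgeLieC := by
  classical
  intro Yop hYe hYΦ hYskew hYtr
  have hHD : exists_isReal_hodgeModel := exists_isReal_hodgeModel_holds
  have hI : hodgePQ_independent_of_hodgeModel := hodgePQ_independent_of_hodgeModel_holds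
  have hP : IsSmoothProjective (Y.prod E).dim (Y.prod E).X := AbelianVariety.isSmoothProjective_holds
  have hXY : IsSmoothProjective Y.dim Y.X := AbelianVariety.isSmoothProjective_holds
  have hXE : IsSmoothProjective E.dim E.X := AbelianVariety.isSmoothProjective_holds
  haveI : Module.Finite ℚ (bettiCohomology (Y.prod E).X 1) := finite_bettiCohomology_one _
  haveI : Module.Finite ℚ (bettiCohomology Y.X 1) := finite_bettiCohomology_one _
  haveI : Module.Finite ℚ (bettiCohomology E.X 1) := finite_bettiCohomology_one _
  -- the bicone of `H¹(Y × E)`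
  let ι₁ := BettiUniverse.pullHodgeHom hHD hI hP hXY (fst Y E).hom.hom.hom 1
  let π₁ := BettiUniverse.pullHodgeHom hHD hI hXY hP (prodLift (𝟙 Y) (0 : Y ⟶ E)).hom.hom.hom 1
  let ι₂ := BettiUniverse.pullHodgeHom hHD hI hP hXE (snd Y E).hom.hom.hom 1
  let π₂ := BettiUniverse.pullHodgeHom hHD hI hXE hP (prodLift (0 : E ⟶ Y) (𝟙 E)).hom.hom.hom 1
  have hsumP : fst Y E ≫ prodLift (𝟙 Y) (0 : Y ⟶ E) + snd Y E ≫ prodLift (0 : E ⟶ Y) (𝟙 E) = 𝟙 _ := by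
    refine prod_hom_ext ?_ ?_
    · rw [Preadditive.add_comp, Category.assoc, Category.assoc, prodLift_fst, prodLift_fst, Category.comp_id,
        comp_zero, add_zero, Category.id_comp]
    · rw [Preadditive.add_comp, Category.assoc, Category.assoc, prodLift_snd, prodLift_snd, Category.comp_id,
        comp_zero, zero_add, Category.id_comp]
  have hπι₁ : ∀ v, π₁.toLinearMap (ι₁.toLinearMap v) = v := fun v => pull_pull_eq_self_of_comp_eq_id (prodLift_fst _ _) v
  have hπι₂ : ∀ v, π₂.toLinearMap (ι₂.toLinearMap v) = v := fun v => pull_pull_eq_self_of_comp_eq_id (prodLift_snd _ _) v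
  have hsum : ∀ v, ι₁.toLinearMap (π₁.toLinearMap v) + ι₂.toLinearMap (π₂.toLinearMap v) = v := fun v =>
    pull_pull_add_pull_pull_eq_self _ _ _ _ hsumP v
  -- effectivity, the Hodge operator of `H¹(Y)`
  have heff := BettiUniverse.hodge_isEffective hHD hP 1
  have heff₁ := BettiUniverse.hodge_isEffective hHD hXY 1
  have heff₂ := BettiUniverse.hodge_isEffective hHD hXE 1
  obtain ⟨Θ₁, hΘ₁⟩ := exists_hodgeTheta (BettiUniverse.hodge hHD hXY 1)
  -- the endomorphisms `φ_Y^*`, `χ^*`, `Φ^*`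
  set φ₁ : Module.End ℚ (bettiCohomology Y.X 1) := (bettiCohomology.map φY.hom.hom.hom 1).hom with hφ₁def
  set φ₂ : Module.End ℚ (bettiCohomology E.X 1) := (bettiCohomology.map χ.hom.hom.hom 1).hom with hφ₂def
  set ΦQ : Module.End ℚ (bettiCohomology (Y.prod E).X 1) := (bettiCohomology.map Φ.hom.hom.hom 1).hom with hΦQdef
  have hφ₁E : φ₁ ∈ (BettiUniverse.hodge hHD hXY 1).endAlg := by
    have h := unop_bettiRep_mem_endAlg hHD hI (AbelianVariety.endAlgebra.of Y φY)
    rwa [bettiRep_of, MulOpposite.unop_op] at h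
  have hφ₂E : φ₂ ∈ (BettiUniverse.hodge hHD hXE 1).endAlg := by
    have h := unop_bettiRep_mem_endAlg hHD hI (AbelianVariety.endAlgebra.of E χ)
    rwa [bettiRep_of, MulOpposite.unop_op] at h
  have hΦE : ΦQ ∈ (BettiUniverse.hodge hHD hP 1).endAlg := by
    have h := unop_bettiRep_mem_endAlg hHD hI (AbelianVariety.endAlgebra.of (Y.prod E) Φ)
    rwa [bettiRep_of, MulOpposite.unop_op] at h
  have hdQ : (0 : ℚ) < d := Nat.cast_pos.2 hd
  have hφ₁sq : φ₁ * φ₁ = -((d : ℚ) • 1) := bettiMapHom_mul_self hφY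
  have hφ₂sq : φ₂ * φ₂ = -((d : ℚ) • 1) := bettiMapHom_mul_self hχ
  have hV₂ : Module.finrank ℚ (bettiCohomology E.X 1) = 2 := by rw [finrank_bettiCohomology_one E, hE1]
  have hμ : (Complex.I * (Real.sqrt d : ℂ)) ^ 2 = -((d : ℚ) : ℂ) := by
    rw [mul_pow, Complex.I_sq, ← Complex.ofReal_pow, Real.sq_sqrt (Nat.cast_nonneg d), Complex.ofReal_natCast,
      Rat.cast_natCast, neg_one_mul]
  have hconj : starRingEnd ℂ (Complex.I * (Real.sqrt d : ℂ)) = -(Complex.I * (Real.sqrt d : ℂ)) := by simp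
  -- the gluing of the `k`-action
  have hΦ₁' : ΦQ ∘ₗ ι₁.toLinearMap = ι₁.toLinearMap ∘ₗ φ₁ := by
    change BettiUniverse.pull Φ.hom.hom.hom 1 ∘ₗ BettiUniverse.pull (fst Y E).hom.hom.hom 1 =
      BettiUniverse.pull (fst Y E).hom.hom.hom 1 ∘ₗ BettiUniverse.pull φY.hom.hom.hom 1
    rw [← pull_comp_eq, ← pull_comp_eq, hΦ₁]
  have hΦ₂' : ΦQ ∘ₗ ι₂.toLinearMap = ι₂.toLinearMap ∘ₗ φ₂ := by
    change BettiUniverse.pull Φ.hom.hom.hom 1 ∘ₗ BettiUniverse.pull (snd Y E).hom.hom.hom 1 =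
      BettiUniverse.pull (snd Y E).hom.hom.hom 1 ∘ₗ BettiUniverse.pull χ.hom.hom.hom 1
    rw [← pull_comp_eq, ← pull_comp_eq, hΦ₂]
  -- the balance at `± i√d` from the Weil type `(3,3)` of the diagonal `k`
  have h10 : ∀ cc, Module.finrank ℂ ↥(Module.End.eigenspace (ΦQ.baseChange ℂ) cc ⊓ (BettiUniverse.hodge hHD hP 1).piece 1 0) =
      eigenMultiplicity (Y.prod E) Φ cc := fun cc => by
    rw [hΦQdef, finrank_eigenspace_inf_piece_oneZero_eq_eigenMultiplicity hHD hI Φ]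
  have h01 : ∀ cc, Module.finrank ℂ ↥(Module.End.eigenspace (ΦQ.baseChange ℂ) cc ⊓ (BettiUniverse.hodge hHD hP 1).piece 0 1) =
      eigenMultiplicity (Y.prod E) Φ (starRingEnd ℂ cc) := fun cc => by
    rw [hΦQdef, finrank_eigenspace_inf_piece_zeroOne_eq_eigenMultiplicity_conj hHD hI Φ]
  have hbal : Module.finrank ℂ ↥(Module.End.eigenspace (ΦQ.baseChange ℂ) (Complex.I * (Real.sqrt d : ℂ)) ⊓
      (BettiUniverse.hodge hHD hP 1).piece 1 0) =
      Module.finrank ℂ ↥(Module.End.eigenspace (ΦQ.baseChange ℂ) (Complex.I * (Real.sqrt d : ℂ)) ⊓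
      (BettiUniverse.hodge hHD hP 1).piece 0 1) := by
    rw [h10, h01, hconj, hW.eigenMultiplicity_eq, hW.eigenMultiplicity_neg_eq]
  have hbal' : Module.finrank ℂ ↥(Module.End.eigenspace (ΦQ.baseChange ℂ) (-(Complex.I * (Real.sqrt d : ℂ))) ⊓
      (BettiUniverse.hodge hHD hP 1).piece 1 0) =
      Module.finrank ℂ ↥(Module.End.eigenspace (ΦQ.baseChange ℂ) (-(Complex.I * (Real.sqrt d : ℂ))) ⊓
      (BettiUniverse.hodge hHD hP 1).piece 0 1) := by
    rw [h10, h01, map_neg, hconj, neg_neg, hW.eigenMultiplicity_eq, hW.eigenMultiplicity_neg_eq]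
  -- `hLie₁` for `Y₅`: the `(2,3)` core through F17's dictionary
  have hsumY := eigenMultiplicity_add_eigenMultiplicity_neg_eq_dim Y φY hd hφY
  have hY0 : 0 < Y.dim := by omega
  have hEY := exists_eq_smul_one_add_smul_bettiMapHom hHD hI hd hφY hE2 hY0
  have h10Y : Module.finrank ℂ ↥(Module.End.eigenspace (φ₁.baseChange ℂ) (Complex.I * (Real.sqrt d : ℂ)) ⊓
      (BettiUniverse.hodge hHD hXY 1).piece 1 0) = eigenMultiplicity Y φY (Complex.I * (Real.sqrt d : ℂ)) := by
    rw [hφ₁def, finrank_eigenspace_inf_piece_oneZero_eq_eigenMultiplicity hHD hI φY]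
  have h01Y : Module.finrank ℂ ↥(Module.End.eigenspace (φ₁.baseChange ℂ) (Complex.I * (Real.sqrt d : ℂ)) ⊓
      (BettiUniverse.hodge hHD hXY 1).piece 0 1) = eigenMultiplicity Y φY (-(Complex.I * (Real.sqrt d : ℂ))) := by
    rw [hφ₁def, finrank_eigenspace_inf_piece_zeroOne_eq_eigenMultiplicity_conj hHD hI φY, hconj]
  have h23' : (Module.finrank ℂ ↥(Module.End.eigenspace (φ₁.baseChange ℂ) (Complex.I * (Real.sqrt d : ℂ)) ⊓
        (BettiUniverse.hodge hHD hXY 1).piece 1 0) = 2 ∧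
      Module.finrank ℂ ↥(Module.End.eigenspace (φ₁.baseChange ℂ) (Complex.I * (Real.sqrt d : ℂ)) ⊓
        (BettiUniverse.hodge hHD hXY 1).piece 0 1) = 3) ∨
      (Module.finrank ℂ ↥(Module.End.eigenspace (φ₁.baseChange ℂ) (Complex.I * (Real.sqrt d : ℂ)) ⊓
        (BettiUniverse.hodge hHD hXY 1).piece 1 0) = 3 ∧
      Module.finrank ℂ ↥(Module.End.eigenspace (φ₁.baseChange ℂ) (Complex.I * (Real.sqrt d : ℂ)) ⊓
        (BettiUniverse.hodge hHD hXY 1).piece 0 1) = 2) := by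
    rw [h10Y, h01Y]
    rcases h23 with h2 | h3
    · exact Or.inl ⟨h2, by omega⟩
    · exact Or.inr ⟨h3, by omega⟩
  have hLie₁ : ∀ (ψ₁ : (BettiUniverse.hodge hHD hXY 1).Polarization) (𝔤₁ : Submodule ℚ (Module.End ℚ (bettiCohomology Y.X 1))),
      (∀ X ∈ 𝔤₁, ∀ X' ∈ 𝔤₁, X * X' - X' * X ∈ 𝔤₁) → Θ₁ ∈ spanC 𝔤₁ →
      (∀ X ∈ 𝔤₁, ∀ a : (BettiUniverse.hodge hHD hXY 1).endAlg,
        X * (a : Module.End ℚ (bettiCohomology Y.X 1)) = (a : Module.End ℚ (bettiCohomology Y.X 1)) * X) →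
      (∀ X ∈ 𝔤₁, ∀ v w, ψ₁.form (X v) w + ψ₁.form v (X w) = 0) →
      ∀ T : Module.End ℂ (ℂ ⊗[ℚ] bettiCohomology Y.X 1), T * φ₁.baseChange ℂ = φ₁.baseChange ℂ * T →
        (∀ x y, ψ₁.form.baseChange ℂ (T x) y + ψ₁.form.baseChange ℂ x (T y) = 0) → T ∈ spanC 𝔤₁ :=
    fun ψ₁ 𝔤₁ hbr hΘ𝔤 hcomm hskew T hTφ hTskew =>
      UnitaryThetaTwoThree.mem_spanC_of_commute_of_skew (BettiUniverse.hodge hHD hXY 1) Nat.cast_one heff₁ ψ₁ hφ₁E hdQ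
        hφ₁sq hEY hμ h23' 𝔤₁ hbr hΘ₁ hΘ𝔤 hcomm hskew hTφ hTskew
  -- the projector hypothesis in the bicone's form
  have he₁ : (ι₁.toLinearMap ∘ₗ π₁.toLinearMap) =
      (bettiCohomology.map (fst Y E ≫ prodLift (𝟙 Y) (0 : Y ⟶ E)).hom.hom.hom 1).hom := by
    change BettiUniverse.pull (fst Y E).hom.hom.hom 1 ∘ₗ BettiUniverse.pull (prodLift (𝟙 Y) (0 : Y ⟶ E)).hom.hom.hom 1 = _
    rw [← pull_comp_eq]
  have hYe' : Yop * (ι₁.toLinearMap ∘ₗ π₁.toLinearMap).baseChange ℂ = (ι₁.toLinearMap ∘ₗ π₁.toLinearMap).baseChange ℂ * Yop := by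
    rw [he₁]; exact hYe
  -- the brick
  exact WeilProductCM.mem_hodgeLieC_of_commute_of_skew_of_trace ι₁ π₁ ι₂ π₂ hπι₁ hπι₂ hsum Nat.cast_one heff heff₂ ψ hφ₁E hφ₂E
    hdQ hφ₁sq hφ₂sq hV₂ hμ hΦE hΦ₁' hΦ₂' hbal hbal' hΘ₁ hLie₁ (fun ψ₁ T hTφ hTskew hTtr => hSL ψ₁ T hTφ hTskew hTtr)
    hYe' hYΦ hYskew hYtr

/-! ### v2: `hSL₁` DISCHARGED by eng-5's K1b (`UnitarySU.mem_span_commutator_of_trace`) — no displayed Lie datum left -/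

/-- **ROW 17 AT THE LIE LEVEL, UNCONDITIONAL IN THE TREE'S STANDING SHAPE** — `hodgeLieC_fivefold_prod_cmCurve_of_twoThree` with its
displayed input `hSL` («`𝔰𝔲_k(H¹Y)_ℂ` is spanned by commutators of `𝔲_k(H¹Y)_ℂ`») DISCHARGED by eng-5 g7's K1b
`UnitarySU.mem_span_commutator_of_trace` (`Motives/HodgeLieUnitarySUDerived`: every weight-one `(H, φ, ψ)` with `φ² = −d` and
`End_Hdg = ℚ + ℚφ`), the latter hypothesis from `finrank_ℚ End⁰(Y) = 2` (`exists_eq_smul_one_add_smul_bettiMapHom`). For every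
polarization `ψ` of `H¹(Y × E; ℚ)`: every operator commuting with the projector `(fst ≫ prodLift (𝟙 Y) 0)^*_ℂ` and with `Φ^*_ℂ`,
`ψ_ℂ`-skew and traceless on `W_k`, lies in `Lie Hg(H¹(Y × E)) ⊗ ℂ`. [cite: MoonenZarhin1999LowDim, §2 (2.4), (2.7) and §5 (5.3), (5.11)]
[cite: Ribet1983, Thm. 3] [cite: Deligne1982HodgeCycles, I §3 Prop. 3.4 and 3.6] -/
theorem hodgeLieC_fivefold_prod_cmCurve_of_twoThree' [HodgeTensorFacts.{0, 0}]
    (hY5 : Y.dim = 5) (φY : Y ⟶ Y) {d : ℕ} (hd : 0 < d) (hφY : φY ≫ φY = -(d • 𝟙 Y))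
    (hE2 : Module.finrank ℚ Y.endAlgebra = 2)
    (h23 : eigenMultiplicity Y φY (Complex.I * (Real.sqrt d : ℂ)) = 2 ∨ eigenMultiplicity Y φY (Complex.I * (Real.sqrt d : ℂ)) = 3)
    (hE1 : E.dim = 1) (χ : E ⟶ E) (hχ : χ ≫ χ = -(d • 𝟙 E))
    (Φ : Y.prod E ⟶ Y.prod E) (hΦ₁ : Φ ≫ fst Y E = fst Y E ≫ φY) (hΦ₂ : Φ ≫ snd Y E = snd Y E ≫ χ)
    (hW : IsWeilType (Y.prod E) Φ 3 d)
    (ψ : (BettiUniverse.hodge exists_isReal_hodgeModel_holds (AbelianVariety.isSmoothProjective_holds (A := Y.prod E)) 1).Polarization) :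
    ∀ (Yop : Module.End ℂ (ℂ ⊗[ℚ] bettiCohomology (Y.prod E).X 1)),
      Yop * ((bettiCohomology.map (fst Y E ≫ prodLift (𝟙 Y) (0 : Y ⟶ E)).hom.hom.hom 1).hom).baseChange ℂ =
        ((bettiCohomology.map (fst Y E ≫ prodLift (𝟙 Y) (0 : Y ⟶ E)).hom.hom.hom 1).hom).baseChange ℂ * Yop →
      ∀ (hYΦ : Yop * ((bettiCohomology.map Φ.hom.hom.hom 1).hom).baseChange ℂ =
        ((bettiCohomology.map Φ.hom.hom.hom 1).hom).baseChange ℂ * Yop),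
      (∀ x y, ψ.form.baseChange ℂ (Yop x) y + ψ.form.baseChange ℂ x (Yop y) = 0) →
      LinearMap.trace ℂ _ (Yop.restrict fun x (hx : x ∈ Module.End.eigenspace
          (((bettiCohomology.map Φ.hom.hom.hom 1).hom).baseChange ℂ) (Complex.I * (Real.sqrt d : ℂ))) =>
        UnitaryTheta.apply_mem_eigenspace_of_commute hYΦ hx) = 0 →
      Yop ∈ (BettiUniverse.hodge exists_isReal_hodgeModel_holds (AbelianVariety.isSmoothProjective_holds (A := Y.prod E)) 1).hodgeLieC := by
  have hHD : exists_isReal_hodgeModel := exists_isReal_hodgeModel_holds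
  have hI : hodgePQ_independent_of_hodgeModel := hodgePQ_independent_of_hodgeModel_holds
  haveI : Module.Finite ℚ (bettiCohomology Y.X 1) := finite_bettiCohomology_one _
  -- `End_Hdg(H¹Y) = ℚ + ℚ φ_Y^*`, `(φ_Y^*)² = -d`
  have hφ₁E : (bettiCohomology.map φY.hom.hom.hom 1).hom ∈
      (BettiUniverse.hodge hHD (AbelianVariety.isSmoothProjective_holds (A := Y)) 1).endAlg := by
    have h := unop_bettiRep_mem_endAlg hHD hI (AbelianVariety.endAlgebra.of Y φY)
    rwa [bettiRep_of, MulOpposite.unop_op] at h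
  have hdQ : (0 : ℚ) < d := Nat.cast_pos.2 hd
  have hφ₁sq : (bettiCohomology.map φY.hom.hom.hom 1).hom * (bettiCohomology.map φY.hom.hom.hom 1).hom = -((d : ℚ) • 1) :=
    bettiMapHom_mul_self hφY
  have hsumY := eigenMultiplicity_add_eigenMultiplicity_neg_eq_dim Y φY hd hφY
  have hY0 : 0 < Y.dim := by omega
  have hEY := exists_eq_smul_one_add_smul_bettiMapHom hHD hI hd hφY hE2 hY0
  exact hodgeLieC_fivefold_prod_cmCurve_of_twoThree hY5 φY hd hφY hE2 h23 hE1 χ hχ Φ hΦ₁ hΦ₂ hW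
    (fun ψ₁ T hTφ hTskew hTtr => UnitarySU.mem_span_commutator_of_trace
      (BettiUniverse.hodge hHD (AbelianVariety.isSmoothProjective_holds (A := Y)) 1) Nat.cast_one ψ₁ hφ₁E hdQ hφ₁sq hEY hTφ
      hTskew hTtr) ψ

end Literature.AlgebraicGeometry.HodgeTheory

end
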